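import Summits.QuantumFields.QCD.Theses.HeatSlicedQuarks
import Summits.QuantumFields.QCD.Theses.GradientFlowSpecies
import Summits.QuantumFields.QCD.Theorems.GluonicCompletion.Negative.Threshold

/-!
# Crux-triage r1/k3 checks for `RobustYangMillsHandover` (stmt-QuantumFields-8892)

Kernel-checked evidence behind two triage verdicts (triager 3, round 1):

* §1 card `existence-pays-the-continuum-half`: its residual `HonestHeavyLatticeGap` is, up to
  `Iff`, the ALREADY TYPED item `GradientFlowSpecies.MassiveLatticeGap` (stmt-QuantumFields-8922), and
  `GapTransfer (8923) → HonestHeavyLatticeGap → RobustYangMillsHandover` holds with the card's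
  `ThresholdShift'` hypothesis discharged by the landed `qcdOf_iff_threshold` (verdict: pass; sharpen).
* §2 card `proper-time-residual-determinant`: its smallness parameter `T·λ_loc` with `T = (ℓ₁/a_k)²`
  and `λ_loc = (C a_k m / Z_m(k))²` (the bare fine-lattice gap) equals `(C ℓ₁ m / Z_m(k))²` and tends
  to `0` along every regularisation with `HasMassScaling` (so the card's bound `6 N_f e^{-x}/x` tends
  to `+∞` and its locality range `a_k/√λ_loc = Z_m(k)/(C m)` to `+∞` in physical units) at FIXED
  `ℓ₁, M₀` — no `k`-uniform `ε(M₀ ℓ₁)` (verdict: fail as stated; repair = block-scale operator).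
-/

namespace Summit.QuantumFields.QCD.Cruxes.RobustYangMillsHandover.TriageR1K3

open Summit.QuantumFields.QCD.Theses
open Summit.QuantumFields.QCD.Theses.HeatSlicedQuarks
open Literature.MathematicalPhysics.QuantumFieldTheory
open Filter Topology

/-! ## §1 `existence-pays-the-continuum-half` -/

/-- The card's residual, verbatim. -/
def HonestHeavyLatticeGap : Prop :=
  ∀ Nf : ℕ, Nf = 2 ∨ Nf = 3 → ∀ reg : QCDRegularisation Nf, reg.HasMassScaling →
    (∀ m : Fin Nf → ℝ, (∀ f, 0 < m f) → ∃ (z shift : QCDField Nf → ℕ → ℝ) (T : OSData (QCDField Nf) 4),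
        IsQCDAlong (reg.scheme m z shift) T ∧ T.IsNontrivial QCDField.glue ∧ T.IsNonGaussian QCDField.glue ∧
          ∀ f g : Fin Nf, f ≠ g → T.IsNontrivial (QCDField.pseudoRe f g)) →
    ∃ M₀ : ℝ, 0 ≤ M₀ ∧ ∀ m : Fin Nf → ℝ, (∀ f, M₀ < m f) →
      ∃ Δ : ℝ, 0 < Δ ∧ ∀ (z shift : QCDField Nf → ℕ → ℝ), (reg.scheme m z shift).HasLatticeMassGap Δ

/-- The lattice gap clause does not read `z, shift`. [folklore] -/
theorem hasLatticeMassGap_scheme_indep {Nf : ℕ} (reg : QCDRegularisation Nf) (m : Fin Nf → ℝ)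
    (z shift z' shift' : QCDField Nf → ℕ → ℝ) (Δ : ℝ) :
    (reg.scheme m z shift).HasLatticeMassGap Δ ↔ (reg.scheme m z' shift').HasLatticeMassGap Δ :=
  Iff.rfl

/-- **The card's C⁺ is the typed item stmt-QuantumFields-8922.** [folklore] -/
theorem honestHeavyLatticeGap_iff_massiveLatticeGap :
    HonestHeavyLatticeGap ↔ GradientFlowSpecies.MassiveLatticeGap := by
  constructor
  · intro h Nf hNf reg hreg
    obtain ⟨M₀, -, hM⟩ := h Nf hNf reg hreg.1 hreg.2
    refine ⟨M₀, fun m hm => ?_⟩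
    obtain ⟨Δ, hΔ, hL⟩ := hM m hm
    exact ⟨Δ, hΔ, hL 0 0⟩
  · intro h Nf hNf reg hms hb
    obtain ⟨M, hM⟩ := h Nf hNf reg ⟨hms, hb⟩
    refine ⟨max M 0, le_max_right _ _, fun m hm => ?_⟩
    obtain ⟨Δ, hΔ, hL⟩ := hM m fun f => lt_of_le_of_lt (le_max_left _ _) (hm f)
    exact ⟨Δ, hΔ, fun z shift => (hasLatticeMassGap_scheme_indep reg m 0 0 z shift Δ).mp hL⟩

/-- `HasLatticeMassGap` is monotone in the rate. [folklore] -/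
theorem hasLatticeMassGap_anti {Nf : ℕ} (sch : QCDScheme Nf) {Δ Δ' : ℝ} (hle : Δ ≤ Δ')
    (h : sch.HasLatticeMassGap Δ') : sch.HasLatticeMassGap Δ := by
  intro R R' A B
  obtain ⟨C, hC⟩ := h R R' A B
  refine ⟨C, ?_⟩
  filter_upwards [hC] with k hk S hS n hn
  refine (hk S hS n hn).trans ?_
  have hC0 : 0 ≤ C := by
    have h1 := (norm_nonneg _).trans (hk S hS n hn)
    exact nonneg_of_mul_nonneg_left h1 (Real.exp_pos _)
  refine mul_le_mul_of_nonneg_left (Real.exp_le_exp.mpr ?_) hC0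
  have : 0 ≤ sch.a k * n := mul_nonneg (sch.a_pos k).le (Nat.cast_nonneg n)
  nlinarith

/-- **The card's reduction, with `ThresholdShift'` discharged by the landed `qcdOf_iff_threshold`:**
`GapTransfer (8923) → HonestHeavyLatticeGap (= 8922) → RobustYangMillsHandover`. [folklore] -/
theorem handover_of_gapTransfer_of_honest (hGT : GradientFlowSpecies.GapTransfer)
    (hH : HonestHeavyLatticeGap) : RobustYangMillsHandover := by
  intro hX
  have key : ∀ Nf, (Nf = 2 ∨ Nf = 3) → QCDOf Nf := by
    intro Nf hNf
    obtain ⟨reg, hms, hb⟩ := hX Nf hNf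
    obtain ⟨M₀, hM₀, hgap⟩ := hH Nf hNf reg hms hb
    refine (Theorems.GluonicCompletion.Negative.qcdOf_iff_threshold Nf).mpr
      ⟨M₀, hM₀, reg, hms, fun m hm => ?_⟩
    have hm0 : ∀ f, 0 < m f := fun f => lt_of_le_of_lt hM₀ (hm f)
    obtain ⟨z, shift, T, hA, hN, hG, hP⟩ := hb m hm0
    obtain ⟨Δ, hΔ, hL⟩ := hgap m hm
    refine ⟨z, shift, T, hA, hN, hG, hP, Δ / 2, half_pos hΔ, ?_, ?_⟩
    · exact hGT Nf (reg.scheme m z shift) T Δ (Δ / 2) (half_pos hΔ) (half_lt_self hΔ) hA (hL z shift)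
    · exact hasLatticeMassGap_anti _ (half_le_self hΔ.le) (hL z shift)
  exact ⟨key 2 (Or.inl rfl), key 3 (Or.inr rfl)⟩

/-- Same, phrased on the tree item. [folklore] -/
theorem handover_of_gapTransfer_of_massiveLatticeGap (hGT : GradientFlowSpecies.GapTransfer)
    (hM : GradientFlowSpecies.MassiveLatticeGap) : RobustYangMillsHandover :=
  handover_of_gapTransfer_of_honest hGT (honestHeavyLatticeGap_iff_massiveLatticeGap.mpr hM)

/-! ## §2 `proper-time-residual-determinant`: the smallness parameter is not `k`-uniform -/

/-- The card's parameter `T · λ_loc` at step `k`: `T = (ℓ₁/a_k)²` (handover proper time for a fixed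
physical block length `ℓ₁`), `λ_loc = (C · a_k m / Z_m(k))²` (the typical bare gap of `D_W†D_W` at the
scheme's bare mass `m_crit(k) + a_k m / Z_m(k)`, `C` a finite renormalisation constant). -/
noncomputable def properTimeParameter {Nf : ℕ} (reg : QCDRegularisation Nf) (ℓ₁ C m : ℝ) (k : ℕ) : ℝ :=
  (ℓ₁ / reg.a k) ^ 2 * (C * reg.a k * m / reg.Zm k) ^ 2

/-- The lattice spacing cancels: `T λ_loc = (C ℓ₁ m / Z_m(k))²`. [folklore] -/
theorem properTimeParameter_eq {Nf : ℕ} (reg : QCDRegularisation Nf) (ℓ₁ C m : ℝ) (k : ℕ) :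
    properTimeParameter reg ℓ₁ C m k = (C * ℓ₁ * m / reg.Zm k) ^ 2 := by
  have ha := (reg.a_pos k).ne'
  have hZ := (reg.Zm_pos k).ne'
  unfold properTimeParameter
  field_simp

/-- `γ₀/(2β₀) > 0` for `N_f ≤ 16`. [folklore] -/
theorem massExponent_pos {Nf : ℕ} (hNf : Nf ≤ 16) : 0 < massExponent Nf := by
  have hNf' : (Nf : ℝ) ≤ 16 := by exact_mod_cast hNf
  have hb : 0 < betaCoeff₀ Nf := by
    simp only [betaCoeff₀]
    apply div_pos _ (by positivity)
    linarith
  have hg : 0 < gammaCoeff₀ := by simp only [gammaCoeff₀]; positivity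
  simp only [massExponent]
  positivity

/-- `HasMassScaling` forces `Z_m(k) → ∞` (`N_f ≤ 16`). [folklore] -/
theorem tendsto_Zm_atTop {Nf : ℕ} (hNf : Nf ≤ 16) (reg : QCDRegularisation Nf)
    (hms : reg.HasMassScaling) : Tendsto reg.Zm atTop atTop := by
  obtain ⟨c, hc, h⟩ := hms
  have ha2 : Tendsto (fun k => reg.a k ^ 2) atTop (𝓝[>] 0) := by
    refine tendsto_nhdsWithin_iff.mpr ⟨?_, Eventually.of_forall fun k => pow_pos (reg.a_pos k) 2⟩
    simpa using (reg.tendsto_a.pow 2)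
  have hlog : Tendsto (fun k => Real.log (1 / reg.a k ^ 2)) atTop atTop :=
    (Real.tendsto_log_atTop.comp ha2.inv_tendsto_nhdsGT_zero).congr fun k => by
      simp only [Function.comp_apply, Pi.inv_apply, one_div]
  have hpow : Tendsto (fun k => Real.log (1 / reg.a k ^ 2) ^ massExponent Nf) atTop atTop :=
    (tendsto_rpow_atTop (massExponent_pos hNf)).comp hlog
  have key : Tendsto (fun k => reg.Zm k / Real.log (1 / reg.a k ^ 2) ^ massExponent Nf *
      Real.log (1 / reg.a k ^ 2) ^ massExponent Nf) atTop atTop :=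
    h.pos_mul_atTop hc hpow
  refine key.congr' ?_
  filter_upwards [hpow.eventually_gt_atTop 0] with k hk
  rw [div_mul_cancel₀ _ hk.ne']

/-- **The card's smallness parameter tends to `0` at fixed `ℓ₁`** (every `C, m`; `N_f ≤ 16`), so
`e^{-Tλ_loc}`-suppression is absent eventually in `k`: no `k`-uniform `ε(M₀ ℓ₁)`. [folklore] -/
theorem properTimeParameter_tendsto_zero {Nf : ℕ} (hNf : Nf ≤ 16) (reg : QCDRegularisation Nf)
    (hms : reg.HasMassScaling) (ℓ₁ C m : ℝ) :
    Tendsto (fun k => properTimeParameter reg ℓ₁ C m k) atTop (𝓝 0) := by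
  have hZ := tendsto_Zm_atTop hNf reg hms
  have h1 : Tendsto (fun k => C * ℓ₁ * m / reg.Zm k) atTop (𝓝 0) :=
    Tendsto.div_atTop tendsto_const_nhds hZ
  have h2 : Tendsto (fun k => (C * ℓ₁ * m / reg.Zm k) ^ 2) atTop (𝓝 0) := by
    simpa using h1.pow 2
  exact h2.congr fun k => (properTimeParameter_eq reg ℓ₁ C m k).symm

/-- **The card's per-site bound `e^{-x}/x` (times `6 N_f`) blows up** along the scheme. [folklore] -/
theorem properTimeBound_tendsto_atTop {Nf : ℕ} (hNf : Nf ≤ 16) (reg : QCDRegularisation Nf)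
    (hms : reg.HasMassScaling) {ℓ₁ C m : ℝ} (hℓ : 0 < ℓ₁) (hC : 0 < C) (hm : 0 < m) :
    Tendsto (fun k => Real.exp (-properTimeParameter reg ℓ₁ C m k) / properTimeParameter reg ℓ₁ C m k)
      atTop atTop := by
  have hpos : ∀ k, 0 < properTimeParameter reg ℓ₁ C m k := fun k => by
    rw [properTimeParameter_eq]
    exact pow_pos (div_pos (by positivity) (reg.Zm_pos k)) 2
  have h0 : Tendsto (fun k => properTimeParameter reg ℓ₁ C m k) atTop (𝓝[>] 0) :=
    tendsto_nhdsWithin_iff.mpr ⟨properTimeParameter_tendsto_zero hNf reg hms ℓ₁ C m,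
      Eventually.of_forall hpos⟩
  have hinv : Tendsto (fun k => (properTimeParameter reg ℓ₁ C m k)⁻¹) atTop atTop :=
    h0.inv_tendsto_nhdsGT_zero
  have hmain : Tendsto (fun k => Real.exp (-1) * (properTimeParameter reg ℓ₁ C m k)⁻¹) atTop atTop :=
    hinv.const_mul_atTop (Real.exp_pos _)
  refine tendsto_atTop_mono' atTop ?_ hmain
  have hle1 : ∀ᶠ k in atTop, properTimeParameter reg ℓ₁ C m k ≤ 1 :=
    (properTimeParameter_tendsto_zero hNf reg hms ℓ₁ C m).eventually (eventually_le_nhds one_pos)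
  filter_upwards [hle1] with k hk
  rw [div_eq_mul_inv]
  refine mul_le_mul_of_nonneg_right (Real.exp_le_exp.mpr (by linarith)) (inv_pos.mpr (hpos k)).le

/-- **The card's locality range in physical units diverges**: `a_k / √λ_loc = Z_m(k)/(C m) → ∞`
(P2's rate `√λ_loc` is the bare cutoff mass, which runs to `0`). [folklore] -/
theorem properTimeRange_tendsto_atTop {Nf : ℕ} (hNf : Nf ≤ 16) (reg : QCDRegularisation Nf)
    (hms : reg.HasMassScaling) {C m : ℝ} (hC : 0 < C) (hm : 0 < m) :
    Tendsto (fun k => reg.a k / (C * reg.a k * m / reg.Zm k)) atTop atTop := by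
  have hZ := tendsto_Zm_atTop hNf reg hms
  have e : ∀ k, reg.a k / (C * reg.a k * m / reg.Zm k) = (C * m)⁻¹ * reg.Zm k := fun k => by
    have ha := (reg.a_pos k).ne'
    field_simp
  simp_rw [e]
  exact hZ.const_mul_atTop (by positivity)

end Summit.QuantumFields.QCD.Cruxes.RobustYangMillsHandover.TriageR1K3
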